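import Literature.AlgebraicGeometry.Hu2025.Statements.S04ModelV.R105aGoverning
import HarnessLib

/-!
# Hu 2025 row 105 — two bookkeeping identities of §4.5 DISCHARGED for the generic model data (kernel; D-lane)

`C31L142_holds` («`𝓑^℘ = ⋃_{F̄ ∈ 𝓕} 𝓑^℘_F`», chunk p0031 l.142–144) and `Eq4_45_holds` ((4.45) «`𝓑 = 𝓑^gov ⊔ 𝓑^ngv ⊔ 𝓑^𝔯𝔟`»,
chunk p0031 l.206 – p0032 l.3) hold for EVERY model datum `(rel, mono, head)` and every `Brb`: they are set bookkeeping on the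
definitions of row 103 (`wpBinomials`) and row 105 (`Bgov`, `BgovIn`, `BngvIn`, `BIn`). Nothing about the manuscript's mathematics is
decided by them; they only certify that the typed renderings of these two displays are consistent. AI-written; weaker than expert review.
-/

noncomputable section

namespace Literature.AlgebraicGeometry.Hu2025.Proofs.S04ModelV

open Literature.AlgebraicGeometry.Hu2025.Statements.S04ModelV

universe u v w x

variable {k : Type u} [CommRing k] {σ : Type v} {T : Type w} {𝔗 : Type x}

/-- `𝓑^℘_Φ` is monotone in the set of relations `Φ`. [cite: Hu2025, §4.5 (4.39)/(4.40)/(4.43)–(4.45), chunk p0031 l.135–150, l.191–206 and p0032 l.1–3 (unrefereed preprint arXiv:2507.21400v1 under adjudication, D-0012/D-0089 — kernel support on OUR typed carriers of rows 103/105; nothing of the source asserted)] -/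
theorem wpBinomials_mono (rel : T → 𝔗) (mono : T → (σ →₀ ℕ)) {Φ Ψ : Set 𝔗} (h : Φ ⊆ Ψ) :
    wpBinomials (k := k) rel mono Φ ⊆ wpBinomials (k := k) rel mono Ψ := by
  rintro b ⟨t, t', hrel, hne, hΦ, hb, hb0⟩
  exact ⟨t, t', hrel, hne, h hΦ, hb, hb0⟩

/-- **`C31L142` holds**: `𝓑^℘ = ⋃_F 𝓑^℘_F` for every model datum. [cite: Hu2025, §4.5 (4.39)/(4.40)/(4.43)–(4.45), chunk p0031 l.135–150, l.191–206 and p0032 l.1–3 (unrefereed preprint arXiv:2507.21400v1 under adjudication, D-0012/D-0089 — kernel support on OUR typed carriers of rows 103/105; nothing of the source asserted)] -/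
theorem C31L142_holds : ∀ {k : Type u} [CommRing k] {σ : Type v} {T : Type w} {𝔗 : Type x}
    (rel : T → 𝔗) (mono : T → (σ →₀ ℕ)), C31L142 (k := k) (σ := σ) rel mono := by
  intro k _ σ T 𝔗 rel mono
  unfold C31L142
  ext b
  simp only [Set.mem_iUnion]
  constructor
  · rintro ⟨t, t', hrel, hne, -, hb, hb0⟩
    exact ⟨rel t, t, t', hrel, hne, rfl, hb, hb0⟩
  · rintro ⟨F, hbF⟩
    exact wpBinomials_mono (k := k) rel mono (Set.subset_univ _) hbF

/-- `𝓑^gov_Φ ⊆ 𝓑^℘_Φ`: governing binomials of the blocks in `Φ` are ℘-binomials of `Φ`. [cite: Hu2025, §4.5 (4.39)/(4.40)/(4.43)–(4.45), chunk p0031 l.135–150, l.191–206 and p0032 l.1–3 (unrefereed preprint arXiv:2507.21400v1 under adjudication, D-0012/D-0089 — kernel support on OUR typed carriers of rows 103/105; nothing of the source asserted)] -/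
theorem bgovIn_subset_wpBinomials (rel : T → 𝔗) (mono : T → (σ →₀ ℕ)) (head : 𝔗 → T) (Φ : Set 𝔗) :
    BgovIn (k := k) rel mono head Φ ⊆ wpBinomials (k := k) rel mono Φ := by
  intro b hb
  simp only [BgovIn, Set.mem_iUnion] at hb
  obtain ⟨F, hF, hbF⟩ := hb
  exact wpBinomials_mono (k := k) rel mono (Set.singleton_subset_iff.mpr hF) hbF.1

/-- **`Eq4_45` holds**: `𝓑 = 𝓑^gov ⊔ 𝓑^ngv ⊔ 𝓑^𝔯𝔟` (as a union of sets) for every model datum and every `𝓑^𝔯𝔟`.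
[cite: Hu2025, §4.5 (4.39)/(4.40)/(4.43)–(4.45), chunk p0031 l.135–150, l.191–206 and p0032 l.1–3 (unrefereed preprint arXiv:2507.21400v1 under adjudication, D-0012/D-0089 — kernel support on OUR typed carriers of rows 103/105; nothing of the source asserted)] -/
theorem Eq4_45_holds : ∀ {k : Type u} [CommRing k] {σ : Type v} {T : Type w} {𝔗 : Type x}
    (rel : T → 𝔗) (mono : T → (σ →₀ ℕ)) (head : 𝔗 → T) (Brb : Set (ModelRing σ T k)),
    Eq4_45 (k := k) rel mono head Brb := by
  intro k _ σ T 𝔗 rel mono head Brb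
  unfold Eq4_45 BIn BngvIn
  have hsub := bgovIn_subset_wpBinomials (k := k) rel mono head (Set.univ : Set 𝔗)
  ext b
  simp only [Set.mem_union, Set.mem_sdiff]
  constructor
  · rintro (hb | hb)
    · by_cases hg : b ∈ BgovIn (k := k) rel mono head Set.univ
      · exact Or.inl (Or.inl hg)
      · exact Or.inl (Or.inr ⟨hb, hg⟩)
    · exact Or.inr hb
  · rintro ((hg | ⟨hb, -⟩) | hb)
    · exact Or.inl (hsub hg)
    · exact Or.inl hb
    · exact Or.inr hb

/-- The AS-PRINTED `𝓑^℘_F` of (4.39) (all ordered pairs of terms, the zero binomial of equal pairs included) contains the OURS reading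
(`wpBinomials rel mono {F}`, Def. 4.6: non-zero binomials of distinct terms). [cite: Hu2025, §4.5 (4.39)/(4.40)/(4.43)–(4.45), chunk p0031 l.135–150, l.191–206 and p0032 l.1–3 (unrefereed preprint arXiv:2507.21400v1 under adjudication, D-0012/D-0089 — kernel support on OUR typed carriers of rows 103/105; nothing of the source asserted)] -/
theorem eq4_39_ours_subset (rel : T → 𝔗) (mono : T → (σ →₀ ℕ)) (F : 𝔗) :
    Eq4_39_ours (k := k) rel mono F ⊆ Eq4_39 (k := k) rel mono F := by
  rintro b ⟨t, t', hrel, -, hF, hb, -⟩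
  have hF' : rel t = F := by simpa using hF
  exact ⟨t, t', hF', hrel ▸ hF', hb⟩

/-- Conversely the AS-PRINTED set adds at most the zero binomial: `Eq4_39 ⊆ 𝓑^℘_F ∪ {0}`. [cite: Hu2025, §4.5 (4.39)/(4.40)/(4.43)–(4.45), chunk p0031 l.135–150, l.191–206 and p0032 l.1–3 (unrefereed preprint arXiv:2507.21400v1 under adjudication, D-0012/D-0089 — kernel support on OUR typed carriers of rows 103/105; nothing of the source asserted)] -/
theorem eq4_39_subset_insert_zero (rel : T → 𝔗) (mono : T → (σ →₀ ℕ)) (F : 𝔗) :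
    Eq4_39 (k := k) rel mono F ⊆ insert 0 (Eq4_39_ours (k := k) rel mono F) := by
  rintro b ⟨t, t', ht, ht', rfl⟩
  by_cases h0 : wpBinomial (k := k) mono t t' = 0
  · exact Or.inl h0
  · refine Or.inr ⟨t, t', ht.trans ht'.symm, ?_, by simpa using ht, rfl, h0⟩
    rintro rfl
    exact h0 (by simp [wpBinomial])

end Literature.AlgebraicGeometry.Hu2025.Proofs.S04ModelV

end
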